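import Mathlib
import Literature.NumberTheory.LFunctions.WeilMarkovQuadratic

/-!
# Small real test functions have small Weil form: `Re Q(w) = O_R(ε²)` in the `C¹` window topology

AWS sprint (cell `pub-rhdoor`, forcing lemma, owner cc-4) — the ONE ANALYTIC ESTIMATE behind the forcing
lemma `WeilPositivityForcing` of `MotivicDoorAWSStructure` (proved from this file in
`AWS/PositivityForcing.lean`).  This file is UNCONDITIONAL real analysis on Weil's explicit functional:
no zero of `ζ`, no RH-derived input, no axiom of the arithmetic Weil surface is used here.  (Honest label
of the sprint, carried on every AWS file: the sprint theorem is a one-way implication from a strengthened,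
prime-side-only axiom system; the existence of such an object is NOT claimed and is the located gap.)

## Main result (0 sorry)

* `exists_re_weilQuadratic_le` — for every `R ≥ 0` there is `K = K(R) ≥ 0` with
  `Re Q(w) = Re W(w ⋆ w̃) ≤ K ε²` for every real test function `w` vanishing off `[-R, R]` with
  `|w| ≤ ε` and `|w'| ≤ ε`.

Proof: the PROVED Markov decomposition `Re Q = P + 𝓔_R − M_R ‖·‖₂²`
(`weilQuadratic_re_eq_weilPoleForm_add_weilDirichletEnergy_sub`: Bombieri's explicit formula with the
archimedean term written as a jump form).  The pole form and `‖w‖₂²` are `O_R(ε²)` from `|w| ≤ ε` on the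
window; the increments obey `D_t(w) ≤ (2R + 2|t|)·min(2ε, ε|t|)²` (mean value theorem,
`weilIncrement_ofReal_le`), which against the archimedean density
`e^{t/2}/(2 sinh t) ≤ e^{1/2}/(2t)` (`t ≤ 1`), `≤ 2e^{-t/2}` (`t ≥ 1`) and the finitely many prime-power
rates `Λ(n)/√n`, `log n < 2R`, is `O_R(ε²)` (`weilArchDensity_mul_weilIncrement_le`).
Also recorded: the weighted `L¹` bound `∫ |w| e^{|t|} ≤ 2R e^R ε` (`weightedL1_le_of_window`) that feeds
the tree's uniform bound for the polarised functional.

References: E. Bombieri, Rend. Mat. Acc. Lincei (9) 11 (2000), Thm 2 (the decomposition);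
A. Weil, Sur les "formules explicites" de la théorie des nombres premiers (1952).
-/

noncomputable section

open Complex Set MeasureTheory Filter Literature.NumberTheory.LFunctions
open scoped Real Topology ComplexConjugate ArithmeticFunction.vonMangoldt ContDiff

namespace Summit.RiemannHypothesis.RiemannHypothesis.Theorems.MotivicDoor.AWS

/-! ## Window bookkeeping: integrals of functions supported in an interval -/

/-- If `G` vanishes off `[a, b]` and `‖G‖ ≤ C` on `[a, b]`, then `‖∫ G‖ ≤ C (b − a)`. -/
theorem norm_integral_le_of_window {E : Type*} [NormedAddCommGroup E] [NormedSpace ℝ E]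
    {G : ℝ → E} {a b C : ℝ} (hab : a ≤ b) (h0 : ∀ x, x ∉ Icc a b → G x = 0)
    (hC : ∀ x ∈ Icc a b, ‖G x‖ ≤ C) : ‖∫ x, G x‖ ≤ C * (b - a) := by
  rw [← setIntegral_eq_integral_of_forall_compl_eq_zero h0]
  calc ‖∫ x in Icc a b, G x‖ ≤ C * volume.real (Icc a b) :=
        norm_setIntegral_le_of_norm_le_const measure_Icc_lt_top hC
    _ = C * (b - a) := by rw [Real.volume_real_Icc, max_eq_left (sub_nonneg.2 hab)]

/-- Real-valued version: if `F` vanishes off `[a, b]` and `|F| ≤ C` there, then `∫ F ≤ C (b − a)`. -/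
theorem integral_le_of_window {F : ℝ → ℝ} {a b C : ℝ} (hab : a ≤ b)
    (h0 : ∀ x, x ∉ Icc a b → F x = 0) (hC : ∀ x ∈ Icc a b, |F x| ≤ C) :
    ∫ x, F x ≤ C * (b - a) :=
  (le_abs_self _).trans (by
    simpa only [Real.norm_eq_abs] using
      norm_integral_le_of_window (E := ℝ) hab h0 (fun x hx ↦ by simpa [Real.norm_eq_abs] using hC x hx))

/-! ## Real test functions: differentiability, support of the complexification -/

section RealTest

variable {w : ℝ → ℝ}

/-- A real function whose complexification is a Weil test function is smooth. -/
theorem contDiff_of_isWeilTest_ofReal (hw : IsWeilTest fun t ↦ (w t : ℂ)) : ContDiff ℝ ∞ w := by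
  have h := Complex.reCLM.contDiff.comp hw.1
  convert h using 1
  funext t
  simp

/-- … hence differentiable. -/
theorem differentiable_of_isWeilTest_ofReal (hw : IsWeilTest fun t ↦ (w t : ℂ)) :
    Differentiable ℝ w :=
  (contDiff_of_isWeilTest_ofReal hw).differentiable (by simp)

/-- The complexification vanishes where `w` does: support control transfers. -/
theorem tsupport_ofReal_subset {S : Set ℝ} (hS : IsClosed S) (h0 : ∀ t, t ∉ S → w t = 0) :
    tsupport (fun t ↦ (w t : ℂ)) ⊆ S :=
  closure_minimal (fun t ht ↦ by
    by_contra h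
    exact ht (by simp [h0 t h])) hS

/-- **Mean value**: `|w(x + t) − w(x)| ≤ ε' |t|` when `|w'| ≤ ε'`. -/
theorem abs_sub_le_of_deriv (hwd : Differentiable ℝ w) {ε' : ℝ} (hw1 : ∀ t, |deriv w t| ≤ ε')
    (x t : ℝ) : |w (x + t) - w x| ≤ ε' * |t| := by
  have h := Convex.norm_image_sub_le_of_norm_deriv_le (f := w) (s := univ) (x := x) (y := x + t)
    (fun y _ ↦ hwd y) (fun y _ ↦ by simpa [Real.norm_eq_abs] using hw1 y) convex_univ
    (mem_univ _) (mem_univ _)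
  simpa [Real.norm_eq_abs] using h

end RealTest

/-! ## Increments and the archimedean density -/

section Increments

variable {w : ℝ → ℝ} {R : ℝ}

/-- **Increment bound on a window**: if `w` vanishes off `[-R, R]` and `|w(x+t) − w(x)| ≤ B`
everywhere, then `D_t(w) = ∫ |w(x+t) − w(x)|² dx ≤ B² (2R + 2|t|)` (the integrand lives on
`[-R − |t|, R + |t|]`). -/
theorem weilIncrement_ofReal_le (hR : 0 ≤ R) (h0 : ∀ s, s ∉ Icc (-R) R → w s = 0) {t B : ℝ}
    (hB : ∀ x, |w (x + t) - w x| ≤ B) :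
    weilIncrement (fun s ↦ (w s : ℂ)) t ≤ B ^ 2 * (2 * R + 2 * |t|) := by
  unfold weilIncrement
  have hB0 : 0 ≤ B := (abs_nonneg _).trans (hB 0)
  have hpt : ∀ x, ‖((w (x + t) : ℝ) : ℂ) - (w x : ℂ)‖ ^ 2 = |w (x + t) - w x| ^ 2 := fun x ↦ by
    rw [← Complex.ofReal_sub, Complex.norm_real, Real.norm_eq_abs]
  simp_rw [hpt]
  have hab : -R - |t| ≤ R + |t| := by linarith [abs_nonneg t]
  have h := integral_le_of_window (F := fun x ↦ |w (x + t) - w x| ^ 2) (C := B ^ 2) hab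
    (fun x hx ↦ by
      rw [mem_Icc, not_and_or, not_le, not_le] at hx
      have hx1 : w x = 0 := h0 x (by
        rw [mem_Icc, not_and_or, not_le, not_le]
        rcases hx with hx | hx
        · exact Or.inl (by linarith [abs_nonneg t])
        · exact Or.inr (by linarith [abs_nonneg t]))
      have hx2 : w (x + t) = 0 := h0 (x + t) (by
        rw [mem_Icc, not_and_or, not_le, not_le]
        rcases hx with hx | hx
        · exact Or.inl (by linarith [le_abs_self t, neg_abs_le t])
        · exact Or.inr (by linarith [le_abs_self t, neg_abs_le t]))
      simp [hx1, hx2])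
    (fun x _ ↦ by
      rw [abs_pow, abs_abs]
      exact pow_le_pow_left₀ (abs_nonneg _) (hB x) 2)
  calc ∫ x, |w (x + t) - w x| ^ 2 ≤ B ^ 2 * (R + |t| - (-R - |t|)) := h
    _ = B ^ 2 * (2 * R + 2 * |t|) := by ring

/-- The archimedean density near the origin: `e^{t/2}/(2 sinh t) ≤ e^{1/2}/(2t)` for `0 < t ≤ 1`
(`sinh t ≥ t`). -/
theorem weilArchDensity_le_of_le_one {t : ℝ} (ht : 0 < t) (ht1 : t ≤ 1) :
    weilArchDensity t ≤ Real.exp (1 / 2) / (2 * t) := by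
  unfold weilArchDensity
  have h1 : Real.exp (t / 2) ≤ Real.exp (1 / 2) := Real.exp_le_exp.2 (by linarith)
  have h2 : 2 * t ≤ 2 * Real.sinh t := by linarith [Real.self_le_sinh_iff.2 ht.le]
  have h3 : 0 < Real.sinh t := Real.sinh_pos_iff.2 ht
  calc Real.exp (t / 2) / (2 * Real.sinh t) ≤ Real.exp (1 / 2) / (2 * Real.sinh t) :=
        div_le_div_of_nonneg_right h1 (by positivity)
    _ ≤ Real.exp (1 / 2) / (2 * t) := div_le_div_of_nonneg_left (Real.exp_pos _).le (by positivity) h2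

/-- The archimedean density away from the origin: `e^{t/2}/(2 sinh t) ≤ 2 e^{-t/2}` for `t ≥ 1`
(`sinh t ≥ e^t/4` there). -/
theorem weilArchDensity_le_of_one_le {t : ℝ} (ht : 1 ≤ t) :
    weilArchDensity t ≤ 2 * Real.exp (-(t / 2)) := by
  unfold weilArchDensity
  have e2 : (2 : ℝ) ≤ Real.exp (2 * t) := by linarith [Real.add_one_le_exp (2 * t)]
  have hprod : Real.exp (-t) * Real.exp (2 * t) = Real.exp t := by
    rw [← Real.exp_add]; ring_nf
  have hneg : Real.exp (-t) ≤ Real.exp t / 2 := by nlinarith [Real.exp_pos (-t), Real.exp_pos t]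
  have hsinh : Real.exp t / 4 ≤ Real.sinh t := by rw [Real.sinh_eq]; linarith
  have hpos : 0 < 2 * (Real.exp t / 4) := by positivity
  calc Real.exp (t / 2) / (2 * Real.sinh t) ≤ Real.exp (t / 2) / (2 * (Real.exp t / 4)) :=
        div_le_div_of_nonneg_left (Real.exp_pos _).le hpos (by linarith)
    _ = 2 * (Real.exp (t / 2) / Real.exp t) := by ring
    _ = 2 * Real.exp (-(t / 2)) := by rw [← Real.exp_sub]; ring_nf

/-- **Pointwise domination of the archimedean energy density** of a `C¹`-small real function on the
window: for `t > 0`,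
`e^{t/2}/(2 sinh t) · D_t(w) ≤ ε² (3 (R+1) e · e^{-t} + 16 (R+4) e^{-t/4})`
(`t ≤ 1`: `D_t ≤ ε² t² (2R+2t)`; `t ≥ 1`: `D_t ≤ 4ε² (2R+2t)` and `t e^{-t/4} ≤ 4`). -/
theorem weilArchDensity_mul_weilIncrement_le (hR : 0 ≤ R) (h0 : ∀ s, s ∉ Icc (-R) R → w s = 0)
    {ε : ℝ} (hw0 : ∀ s, |w s| ≤ ε) (hwd : Differentiable ℝ w) (hw1 : ∀ s, |deriv w s| ≤ ε)
    {t : ℝ} (ht : 0 < t) :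
    weilArchDensity t * weilIncrement (fun s ↦ (w s : ℂ)) t ≤
      ε ^ 2 * (3 * (R + 1) * Real.exp 1 * Real.exp (-1 * t) + 16 * (R + 4) * Real.exp (-(1 / 4) * t)) := by
  have hε : 0 ≤ ε := (abs_nonneg _).trans (hw0 0)
  have hwpos : 0 ≤ weilArchDensity t := (weilArchDensity_pos ht).le
  have hD0 : 0 ≤ weilIncrement (fun s ↦ (w s : ℂ)) t := weilIncrement_nonneg _ _
  have hA : 0 ≤ 3 * (R + 1) * Real.exp 1 * Real.exp (-1 * t) := by positivity
  have hBpos : 0 ≤ 16 * (R + 4) * Real.exp (-(1 / 4) * t) := by positivity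
  rcases le_or_gt t 1 with ht1 | ht1
  · -- near the origin: mean-value bound `|w(x+t) − w(x)| ≤ ε t`
    have hD : weilIncrement (fun s ↦ (w s : ℂ)) t ≤ (ε * |t|) ^ 2 * (2 * R + 2 * |t|) :=
      weilIncrement_ofReal_le hR h0 (abs_sub_le_of_deriv hwd hw1 · t)
    rw [abs_of_pos ht] at hD
    have hw' := weilArchDensity_le_of_le_one ht ht1
    have he : Real.exp (1 / 2) ≤ 3 := by
      have := Real.exp_one_lt_d9
      linarith [Real.exp_le_exp.2 (show (1 / 2 : ℝ) ≤ 1 by norm_num)]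
    have he1 : 1 ≤ Real.exp 1 * Real.exp (-1 * t) := by
      rw [← Real.exp_add]
      exact Real.one_le_exp (by linarith)
    calc weilArchDensity t * weilIncrement (fun s ↦ (w s : ℂ)) t
        ≤ (Real.exp (1 / 2) / (2 * t)) * ((ε * t) ^ 2 * (2 * R + 2 * t)) :=
          mul_le_mul hw' hD hD0 (by positivity)
      _ = Real.exp (1 / 2) * (ε ^ 2 * (t * (R + t))) := by
          rw [div_mul_eq_mul_div, div_eq_iff (by positivity)]; ring
      _ ≤ 3 * (ε ^ 2 * (1 * (R + 1))) := by
          apply mul_le_mul he _ (by positivity) (by norm_num)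
          exact mul_le_mul_of_nonneg_left (mul_le_mul ht1 (by linarith) (by positivity) zero_le_one)
            (sq_nonneg _)
      _ = ε ^ 2 * (3 * (R + 1)) * 1 := by ring
      _ ≤ ε ^ 2 * (3 * (R + 1)) * (Real.exp 1 * Real.exp (-1 * t)) :=
          mul_le_mul_of_nonneg_left he1 (by positivity)
      _ = ε ^ 2 * (3 * (R + 1) * Real.exp 1 * Real.exp (-1 * t)) := by ring
      _ ≤ ε ^ 2 * (3 * (R + 1) * Real.exp 1 * Real.exp (-1 * t) +
            16 * (R + 4) * Real.exp (-(1 / 4) * t)) := by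
          exact mul_le_mul_of_nonneg_left (le_add_of_nonneg_right hBpos) (sq_nonneg _)
  · -- away from the origin: crude bound `|w(x+t) − w(x)| ≤ 2ε`
    have h2ε : ∀ x, |w (x + t) - w x| ≤ 2 * ε := fun x ↦
      (abs_sub _ _).trans (by linarith [hw0 (x + t), hw0 x])
    have hD : weilIncrement (fun s ↦ (w s : ℂ)) t ≤ (2 * ε) ^ 2 * (2 * R + 2 * |t|) :=
      weilIncrement_ofReal_le hR h0 h2ε
    rw [abs_of_pos ht] at hD
    have hw' := weilArchDensity_le_of_one_le ht1.le
    -- `t e^{-t/4} ≤ 4` and `R e^{-t/4} ≤ R`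
    have hy : Real.exp (-(t / 2)) = Real.exp (-(1 / 4) * t) * Real.exp (-(1 / 4) * t) := by
      rw [← Real.exp_add]; ring_nf
    have hY : t / 4 + 1 ≤ Real.exp (t / 4) := Real.add_one_le_exp _
    have hyY : Real.exp (-(1 / 4) * t) * Real.exp (t / 4) = 1 := by
      rw [← Real.exp_add, show -(1 / 4 : ℝ) * t + t / 4 = 0 by ring, Real.exp_zero]
    have hy1 : Real.exp (-(1 / 4) * t) ≤ 1 := Real.exp_le_one_iff.2 (by linarith)
    have hy0 : 0 < Real.exp (-(1 / 4) * t) := Real.exp_pos _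
    have hkey : (R + t) * Real.exp (-(1 / 4) * t) ≤ R + 4 := by nlinarith
    calc weilArchDensity t * weilIncrement (fun s ↦ (w s : ℂ)) t
        ≤ (2 * Real.exp (-(t / 2))) * ((2 * ε) ^ 2 * (2 * R + 2 * t)) :=
          mul_le_mul hw' hD hD0 (by positivity)
      _ = 16 * ε ^ 2 * (((R + t) * Real.exp (-(1 / 4) * t)) * Real.exp (-(1 / 4) * t)) := by
          rw [hy]; ring
      _ ≤ 16 * ε ^ 2 * ((R + 4) * Real.exp (-(1 / 4) * t)) := by
          exact mul_le_mul_of_nonneg_left (mul_le_mul_of_nonneg_right hkey hy0.le) (by positivity)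
      _ = ε ^ 2 * (16 * (R + 4) * Real.exp (-(1 / 4) * t)) := by ring
      _ ≤ ε ^ 2 * (3 * (R + 1) * Real.exp 1 * Real.exp (-1 * t) +
            16 * (R + 4) * Real.exp (-(1 / 4) * t)) :=
          mul_le_mul_of_nonneg_left (le_add_of_nonneg_left hA) (sq_nonneg _)

/-- The dominating function is integrable on `(0, ∞)`. -/
theorem integrableOn_archDominator (R : ℝ) :
    IntegrableOn (fun t : ℝ ↦ 3 * (R + 1) * Real.exp 1 * Real.exp (-1 * t) +
      16 * (R + 4) * Real.exp (-(1 / 4) * t)) (Ioi 0) :=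
  (((exp_neg_integrableOn_Ioi 0 one_pos).const_mul _).add
    ((exp_neg_integrableOn_Ioi 0 (by norm_num : (0 : ℝ) < 1 / 4)).const_mul _))

end Increments

/-! ## The analytic estimate: `Re Q(w) = O_R(ε²)` for `C¹`-small `w` on the window -/

/-- **TEST-CLASS-DOWN (the one analytic estimate of the sprint).**  For every `R ≥ 0` there is a
constant `K = K(R) ≥ 0` such that every real test function `w` supported in `[-R, R]` with
`|w| ≤ ε` and `|w'| ≤ ε` has `Re Q(w) = Re W(w ⋆ w̃) ≤ K ε²`.  (Markov decomposition
`Re Q = P + 𝓔_R − M_R‖·‖₂²`; pole form, `L²` norm and the jump energy are each `O_R(ε²)`.) -/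
theorem exists_re_weilQuadratic_le {R : ℝ} (hR : 0 ≤ R) :
    ∃ K : ℝ, 0 ≤ K ∧ ∀ (w : ℝ → ℝ) (ε : ℝ), IsWeilTest (fun t ↦ (w t : ℂ)) →
      (∀ t, t ∉ Icc (-R) R → w t = 0) → (∀ t, |w t| ≤ ε) → (∀ t, |deriv w t| ≤ ε) →
        (weilQuadratic fun t ↦ (w t : ℂ)).re ≤ K * ε ^ 2 := by
  -- the constants of the window
  set S : ℝ := ∑ n ∈ weilPrimeIndex R, (Λ n : ℝ) / Real.sqrt n with hS
  set J : ℝ := ∫ t in Ioi (0 : ℝ), (3 * (R + 1) * Real.exp 1 * Real.exp (-1 * t) +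
      16 * (R + 4) * Real.exp (-(1 / 4) * t)) with hJ
  have hS0 : 0 ≤ S := Finset.sum_nonneg fun n _ ↦
    div_nonneg ArithmeticFunction.vonMangoldt_nonneg (Real.sqrt_nonneg _)
  have hJ0 : 0 ≤ J := setIntegral_nonneg measurableSet_Ioi fun t _ ↦ by positivity
  refine ⟨8 * R ^ 2 * Real.cosh (R / 2) ^ 2 + 24 * R * S + J + |weilMarkovConstant R| * (2 * R),
    by positivity, ?_⟩
  intro w ε hw h0 hw0 hw1
  have hε : 0 ≤ ε := (abs_nonneg _).trans (hw0 0)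
  have hwd := differentiable_of_isWeilTest_ofReal hw
  have hsupp : tsupport (fun t ↦ (w t : ℂ)) ⊆ Icc (-R) R := tsupport_ofReal_subset isClosed_Icc h0
  have hRR : -R ≤ R := by linarith
  -- (1) the pole form
  have hcosh : ‖∫ t : ℝ, (w t : ℂ) * (Real.cosh (t / 2) : ℂ)‖ ≤ ε * Real.cosh (R / 2) * (R - -R) := by
    refine norm_integral_le_of_window hRR (fun t ht ↦ by simp [h0 t ht]) fun t ht ↦ ?_
    rw [norm_mul, Complex.norm_real, Complex.norm_real, Real.norm_eq_abs, Real.norm_eq_abs,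
      abs_of_pos (Real.cosh_pos _)]
    refine mul_le_mul (hw0 t) ?_ (Real.cosh_pos _).le hε
    rw [← Real.cosh_abs (t / 2), ← Real.cosh_abs (R / 2)]
    refine Real.cosh_le_cosh.2 ?_
    rw [abs_abs, abs_abs, abs_div, abs_div, abs_two]
    exact div_le_div_of_nonneg_right ((abs_le.2 ⟨by linarith [ht.1], ht.2⟩).trans (le_abs_self R))
      zero_le_two
  have hP : weilPoleForm (fun t ↦ (w t : ℂ)) ≤ 8 * R ^ 2 * Real.cosh (R / 2) ^ 2 * ε ^ 2 := by
    unfold weilPoleForm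
    have h1 : ‖∫ t : ℝ, (w t : ℂ) * (Real.cosh (t / 2) : ℂ)‖ ^ 2 ≤
        (ε * Real.cosh (R / 2) * (R - -R)) ^ 2 := pow_le_pow_left₀ (norm_nonneg _) hcosh 2
    nlinarith [sq_nonneg ‖∫ t : ℝ, (w t : ℂ) * (Real.sinh (t / 2) : ℂ)‖]
  -- (2) the `L²` norm
  have hL2 : ∫ x : ℝ, ‖(w x : ℂ)‖ ^ 2 ≤ ε ^ 2 * (R - -R) :=
    integral_le_of_window hRR (fun x hx ↦ by simp [h0 x hx]) fun x _ ↦ by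
      rw [Complex.norm_real, Real.norm_eq_abs, abs_pow, abs_abs]
      exact pow_le_pow_left₀ (abs_nonneg _) (hw0 x) 2
  have hL2' : 0 ≤ ∫ x : ℝ, ‖(w x : ℂ)‖ ^ 2 := integral_nonneg fun x ↦ by positivity
  -- (3) the prime-power part of the energy
  have h2ε : ∀ t x, |w (x + t) - w x| ≤ 2 * ε := fun t x ↦
    (abs_sub _ _).trans (by linarith [hw0 (x + t), hw0 x])
  have hprime : ∑ n ∈ weilPrimeIndex R, (Λ n : ℝ) / Real.sqrt n *
      weilIncrement (fun s ↦ (w s : ℂ)) (Real.log n) ≤ 24 * R * S * ε ^ 2 := by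
    have hterm : ∀ n ∈ weilPrimeIndex R,
        (Λ n : ℝ) / Real.sqrt n * weilIncrement (fun s ↦ (w s : ℂ)) (Real.log n) ≤
          (Λ n : ℝ) / Real.sqrt n * (24 * R * ε ^ 2) := by
      intro n hn
      have hlog : Real.log n < 2 * R := mem_weilPrimeIndex.1 hn
      have hlog0 : 0 ≤ Real.log (n : ℝ) := Real.log_natCast_nonneg n
      refine mul_le_mul_of_nonneg_left ?_
        (div_nonneg ArithmeticFunction.vonMangoldt_nonneg (Real.sqrt_nonneg _))
      calc weilIncrement (fun s ↦ (w s : ℂ)) (Real.log n)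
          ≤ (2 * ε) ^ 2 * (2 * R + 2 * |Real.log (n : ℝ)|) := weilIncrement_ofReal_le hR h0 (h2ε _)
        _ ≤ (2 * ε) ^ 2 * (2 * R + 2 * (2 * R)) := by
            rw [abs_of_nonneg hlog0]
            exact mul_le_mul_of_nonneg_left (by linarith) (sq_nonneg _)
        _ = 24 * R * ε ^ 2 := by ring
    calc ∑ n ∈ weilPrimeIndex R, (Λ n : ℝ) / Real.sqrt n * weilIncrement (fun s ↦ (w s : ℂ)) (Real.log n)
        ≤ ∑ n ∈ weilPrimeIndex R, (Λ n : ℝ) / Real.sqrt n * (24 * R * ε ^ 2) := Finset.sum_le_sum hterm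
      _ = 24 * R * S * ε ^ 2 := by rw [← Finset.sum_mul, ← hS]; ring
  -- (4) the archimedean part of the energy
  have harch : ∫ t in Ioi (0 : ℝ), weilArchDensity t * weilIncrement (fun s ↦ (w s : ℂ)) t ≤
      J * ε ^ 2 := by
    have hdom := integrableOn_archDominator R
    calc ∫ t in Ioi (0 : ℝ), weilArchDensity t * weilIncrement (fun s ↦ (w s : ℂ)) t
        ≤ ∫ t in Ioi (0 : ℝ), ε ^ 2 * (3 * (R + 1) * Real.exp 1 * Real.exp (-1 * t) +
            16 * (R + 4) * Real.exp (-(1 / 4) * t)) :=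
          setIntegral_mono_on (integrableOn_weilArchDensity_mul_weilIncrement hw)
            (hdom.const_mul _) measurableSet_Ioi
            fun t ht ↦ weilArchDensity_mul_weilIncrement_le hR h0 hw0 hwd hw1 ht
      _ = J * ε ^ 2 := by rw [integral_const_mul, hJ, mul_comm]
  -- assemble with the Markov decomposition
  have hE : weilDirichletEnergy R (fun t ↦ (w t : ℂ)) ≤ (24 * R * S + J) * ε ^ 2 := by
    unfold weilDirichletEnergy; linarith
  have hM : -(weilMarkovConstant R * ∫ x : ℝ, ‖(w x : ℂ)‖ ^ 2) ≤
      |weilMarkovConstant R| * (2 * R) * ε ^ 2 := by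
    have h1 : -(weilMarkovConstant R * ∫ x : ℝ, ‖(w x : ℂ)‖ ^ 2) ≤
        |weilMarkovConstant R| * ∫ x : ℝ, ‖(w x : ℂ)‖ ^ 2 := by
      rw [← neg_mul]
      exact mul_le_mul_of_nonneg_right (neg_le_abs _) hL2'
    have h2 : |weilMarkovConstant R| * (∫ x : ℝ, ‖(w x : ℂ)‖ ^ 2) ≤
        |weilMarkovConstant R| * (ε ^ 2 * (R - -R)) := mul_le_mul_of_nonneg_left hL2 (abs_nonneg _)
    linarith
  rw [weilQuadratic_re_eq_weilPoleForm_add_weilDirichletEnergy_sub hw hsupp]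
  nlinarith

/-! ## The weighted `L¹` norm of a small test function on the window -/

/-- For a fixed real test `u` supported in `[-R, R]` and a real test `w` with `|w| ≤ ε` vanishing off
`[-R, R]`: the weighted `L¹` norm of the uniform bound is `≤ ε e^R · 2R`. -/
theorem weightedL1_le_of_window {w : ℝ → ℝ} {R ε : ℝ} (hR : 0 ≤ R)
    (h0 : ∀ t, t ∉ Icc (-R) R → w t = 0) (hw0 : ∀ t, |w t| ≤ ε) :
    ∫ t : ℝ, ‖((w t : ℝ) : ℂ)‖ * Real.exp (1 * |t|) ≤ ε * Real.exp R * (2 * R) := by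
  have hε : 0 ≤ ε := (abs_nonneg _).trans (hw0 0)
  have h := integral_le_of_window (F := fun t ↦ ‖((w t : ℝ) : ℂ)‖ * Real.exp (1 * |t|))
    (C := ε * Real.exp R) (by linarith : -R ≤ R) (fun t ht ↦ by simp [h0 t ht]) fun t ht ↦ by
      rw [abs_of_nonneg (by positivity), Complex.norm_real, Real.norm_eq_abs, one_mul]
      exact mul_le_mul (hw0 t) (Real.exp_le_exp.2 (abs_le.2 ⟨by linarith [ht.1], ht.2⟩))
        (Real.exp_pos _).le hε
  calc ∫ t : ℝ, ‖((w t : ℝ) : ℂ)‖ * Real.exp (1 * |t|) ≤ ε * Real.exp R * (R - -R) := h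
    _ = ε * Real.exp R * (2 * R) := by ring

end Summit.RiemannHypothesis.RiemannHypothesis.Theorems.MotivicDoor.AWS

end
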